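import Mathlib
import HarnessLib
import Literature.Analysis.FluidPDE.VectorCalculus
import Summits.NavierStokesRegularity.NavierStokesRegularity.Theorems.UnthreadedRigidityDoorUnthreadedRigidityVirialHornAngularLemma
import Summits.NavierStokesRegularity.NavierStokesRegularity.Theorems.UnthreadedRigidityDoorUnthreadedRigidityThreadingJetsVirialFields

/-!
# W2 door `UnthreadedRigidity` — LINE g12-1 «CO-ZONAL»: support CZ-a `CommutingAngularSilence`, I — the transfer package

engine-1 g71 (KEY-NS #205 (d)).  Two solid harmonics `Y₁, Y₂` of DIFFERENT degrees that Poisson-commute (`{Y₁,Y₂} ≡ 0`), with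
`Y₂ ≢ 0`, have `𝒜(Y₁) = {Y₁,|∇Y₁|²} ≡ 0`.  THE TRANSFER LAW: on the dense open set `U = {R₂ = y × ∇Y₂ ≠ 0}` one has
`∇Y₁ = λ∇Y₂ + μy` with `λ = ⟪R₁,R₂⟫/|R₂|²`, `μ = (l₁Y₁ − λl₂Y₂)/|y|²` smooth; differentiating (this file's POINTWISE PACKAGE, §1):
`D(∇Y₁)w = (Dλw)∇Y₂ + λD(∇Y₂)w + (Dμw)y + μw`, whence by symmetry of the Hessians, Euler and the traces: `Dλ(R₂) = Dμ(R₂) = 0`,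
`Dλ(y) = (l₁−l₂)λ`, `Dμ(y) = (l₁−2)μ`, `Dλ(∇Y₂) = −(l₁+1)μ`, and `𝒜(Y₁) = λ³𝒜(Y₂)`.  §2 THE SECOND-ORDER STEP (symmetric `D²λ`):
`(Dλ·τ₂)·𝒜(Y₂) = 0` (`τ₂ = R₂ × y`).  §3 THE ALTERNATIVE on `V = U ∩ {𝒜(Y₁) ≠ 0}`: there `l₁(l₁+1)Y₁ = l₂(l₂+1)λY₂`, whose
derivative along `τ₂` gives `(l₁(l₁+1) − l₂(l₂+1))λ|R₂|² = 0`, i.e. `λ = 0` — contradiction; so `𝒜(Y₁) = 0` on `U`.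

LABEL: support lemma of a MODEL line (W2 door, item 27585 OPEN); multivariable calculus of explicit fields; not a statement about
the Navier–Stokes equations.  0 kit.
-/

-- the summit and its single sub-problem share the name (CONVENTIONS §1), as in every Theorems file
set_option linter.dupNamespace false

namespace Summit.NavierStokesRegularity.NavierStokesRegularity.Theorems.UnthreadedRigidity.CoZonal

open scoped Topology InnerProductSpace
open Filter Set
open Literature.Analysis.FluidPDE (cross crossCLM crossCLM_apply hasFDerivAt_cross)
open Summit.NavierStokesRegularity.NavierStokesRegularity.Theorems.UnthreadedRigidity.VirialHorn
open Summit.NavierStokesRegularity.NavierStokesRegularity.Theorems.UnthreadedRigidity.ProfileHorn (E3)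
open Summit.NavierStokesRegularity.NavierStokesRegularity.Theorems.UnthreadedRigidity.ThreadingJets (contDiff_cross_gradient
  contDiff_angForm)

/-! ## §0 Coordinates (private copies, as in the other files of this door) -/

/-- components of the cross product. -/
private theorem cross_apply_zero (u v : E3) : cross u v 0 = u 1 * v 2 - u 2 * v 1 := by simp [cross, cross_apply]
/-- components of the cross product. -/
private theorem cross_apply_one (u v : E3) : cross u v 1 = u 2 * v 0 - u 0 * v 2 := by simp [cross, cross_apply]
/-- components of the cross product. -/
private theorem cross_apply_two (u v : E3) : cross u v 2 = u 0 * v 1 - u 1 * v 0 := by simp [cross, cross_apply]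
/-- the inner product in coordinates. -/
private theorem real_inner_e3 (u v : E3) : ⟪u, v⟫_ℝ = u 0 * v 0 + u 1 * v 1 + u 2 * v 2 := by
  simp [PiLp.inner_apply, Fin.sum_univ_three, mul_comm]

/-- Lagrange: `|u × v|² = |u|²|v|² − ⟪u,v⟫²`. -/
private theorem inner_cross_self_eq (u v : E3) :
    ⟪cross u v, cross u v⟫_ℝ = ⟪u, u⟫_ℝ * ⟪v, v⟫_ℝ - ⟪u, v⟫_ℝ ^ 2 := by
  simp only [real_inner_e3, cross_apply_zero, cross_apply_one, cross_apply_two]; ring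

/-- `y × (a + b) = y × a + y × b`, `y × (c • a) = c • (y × a)`, `y × y = 0` packaged: `y × (c • a + d • y) = c • (y × a)`. -/
private theorem cross_smul_add_smul_self (y a : E3) (c d : ℝ) : cross y (c • a + d • y) = c • cross y a := by
  ext i
  fin_cases i <;> simp [cross_apply_zero, cross_apply_one, cross_apply_two] <;> ring

/-- `⟪v, eᵢ⟫ = vᵢ`. -/
private theorem inner_e_right (v : E3) (i : Fin 3) : ⟪v, e i⟫_ℝ = v i := by
  simp [e, EuclideanSpace.inner_single_right]

/-- a linear functional in coordinates: `Σᵢ Λ(eᵢ)⟪v, eᵢ⟫ = Λ v`. -/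
private theorem clm_sum_coord (Λ : E3 →L[ℝ] ℝ) (v : E3) : ∑ i : Fin 3, Λ (e i) * ⟪v, e i⟫_ℝ = Λ v := by
  have hv : v = v 0 • e 0 + v 1 • e 1 + v 2 • e 2 := by
    ext j
    fin_cases j <;> simp [e]
  conv_rhs => rw [hv]
  simp only [map_add, map_smul, smul_eq_mul, Fin.sum_univ_three, inner_e_right]
  ring

/-! ## §1 The pointwise package -/

section Pointwise

variable {l₁ l₂ : ℕ} {Y₁ Y₂ : E3 → ℝ} {y : E3} {lam mu : ℝ} {Λ M : E3 →L[ℝ] ℝ}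

/-- expansion of `⟪H₁ w, v⟫` under the Hessian transfer. -/
theorem transfer_inner_apply
    (hE : ∀ w : E3, fderiv ℝ (gradient Y₁) y w =
      Λ w • gradient Y₂ y + lam • fderiv ℝ (gradient Y₂) y w + M w • y + mu • w) (v w : E3) :
    ⟪fderiv ℝ (gradient Y₁) y w, v⟫_ℝ = Λ w * ⟪gradient Y₂ y, v⟫_ℝ + lam * ⟪fderiv ℝ (gradient Y₂) y w, v⟫_ℝ
      + M w * ⟪y, v⟫_ℝ + mu * ⟪w, v⟫_ℝ := by
  rw [hE w]
  simp only [inner_add_left, real_inner_smul_left]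

/-- THE SYMMETRY RELATION `Λw ⟪∇Y₂,v⟫ + Mw ⟪y,v⟫ = Λv ⟪∇Y₂,w⟫ + Mv ⟪y,w⟫` (both Hessians are symmetric). -/
theorem transfer_symm (hY₁ : IsSolidHarmonic l₁ Y₁) (hY₂ : IsSolidHarmonic l₂ Y₂)
    (hE : ∀ w : E3, fderiv ℝ (gradient Y₁) y w =
      Λ w • gradient Y₂ y + lam • fderiv ℝ (gradient Y₂) y w + M w • y + mu • w) (v w : E3) :
    Λ w * ⟪gradient Y₂ y, v⟫_ℝ + M w * ⟪y, v⟫_ℝ = Λ v * ⟪gradient Y₂ y, w⟫_ℝ + M v * ⟪y, w⟫_ℝ := by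
  have h1 := transfer_inner_apply hE v w
  have h2 := transfer_inner_apply hE w v
  have hs₁ : ⟪fderiv ℝ (gradient Y₁) y w, v⟫_ℝ = ⟪fderiv ℝ (gradient Y₁) y v, w⟫_ℝ := by
    rw [hY₁.hessian_symm, real_inner_comm]
  have hs₂ : ⟪fderiv ℝ (gradient Y₂) y w, v⟫_ℝ = ⟪fderiv ℝ (gradient Y₂) y v, w⟫_ℝ := by
    rw [hY₂.hessian_symm, real_inner_comm]
  have hc : ⟪w, v⟫_ℝ = ⟪v, w⟫_ℝ := real_inner_comm _ _
  rw [hs₁, hs₂, hc] at h1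
  linarith

/-- THE 2×2 SYSTEM: `Dλ(R₂) = 0` and `Dμ(R₂) = 0` (the symmetry relation on `(R₂,y)` and `(R₂,∇Y₂)`; determinant `−|R₂|²`). -/
theorem transfer_firstIntegrals (hY₁ : IsSolidHarmonic l₁ Y₁) (hY₂ : IsSolidHarmonic l₂ Y₂)
    (hE : ∀ w : E3, fderiv ℝ (gradient Y₁) y w =
      Λ w • gradient Y₂ y + lam • fderiv ℝ (gradient Y₂) y w + M w • y + mu • w)
    (hR : cross y (gradient Y₂ y) ≠ 0) :
    Λ (cross y (gradient Y₂ y)) = 0 ∧ M (cross y (gradient Y₂ y)) = 0 := by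
  have hRg : ⟪gradient Y₂ y, cross y (gradient Y₂ y)⟫_ℝ = 0 := by
    rw [real_inner_comm]; exact inner_cross_self_right _ _
  have hRy : ⟪y, cross y (gradient Y₂ y)⟫_ℝ = 0 := by
    rw [real_inner_comm]; exact inner_cross_self_left _ _
  have hP : ⟪gradient Y₂ y, y⟫_ℝ = ⟪y, gradient Y₂ y⟫_ℝ := real_inner_comm _ _
  have e1 := transfer_symm hY₁ hY₂ hE y (cross y (gradient Y₂ y))
  have e2 := transfer_symm hY₁ hY₂ hE (gradient Y₂ y) (cross y (gradient Y₂ y))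
  rw [hRg, hRy, mul_zero, mul_zero, add_zero, hP] at e1
  rw [hRg, hRy, mul_zero, mul_zero, add_zero] at e2
  have hL := inner_cross_self_eq y (gradient Y₂ y)
  have hpos : 0 < ⟪cross y (gradient Y₂ y), cross y (gradient Y₂ y)⟫_ℝ := real_inner_self_pos.2 hR
  have ha : Λ (cross y (gradient Y₂ y)) * ⟪cross y (gradient Y₂ y), cross y (gradient Y₂ y)⟫_ℝ = 0 := by
    rw [hL]; linear_combination ⟪y, y⟫_ℝ * e2 - ⟪y, gradient Y₂ y⟫_ℝ * e1
  have hb : M (cross y (gradient Y₂ y)) * ⟪cross y (gradient Y₂ y), cross y (gradient Y₂ y)⟫_ℝ = 0 := by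
    rw [hL]; linear_combination ⟪gradient Y₂ y, gradient Y₂ y⟫_ℝ * e1 - ⟪y, gradient Y₂ y⟫_ℝ * e2
  exact ⟨(mul_eq_zero.1 ha).resolve_right hpos.ne', (mul_eq_zero.1 hb).resolve_right hpos.ne'⟩

/-- EULER FOR `λ`: `Dλ(y) = (l₁ − l₂) λ` (the transfer tested on `y` against `τ₂ = R₂ × y`). -/
theorem transfer_euler_lam (hY₁ : IsSolidHarmonic l₁ Y₁) (hY₂ : IsSolidHarmonic l₂ Y₂)
    (hF : gradient Y₁ y = lam • gradient Y₂ y + mu • y)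
    (hE : ∀ w : E3, fderiv ℝ (gradient Y₁) y w =
      Λ w • gradient Y₂ y + lam • fderiv ℝ (gradient Y₂) y w + M w • y + mu • w)
    (hR : cross y (gradient Y₂ y) ≠ 0) :
    Λ y = ((l₁ : ℝ) - l₂) * lam := by
  have hpos : 0 < ⟪cross y (gradient Y₂ y), cross y (gradient Y₂ y)⟫_ℝ := real_inner_self_pos.2 hR
  have f2 : ⟪gradient Y₂ y, cross (cross y (gradient Y₂ y)) y⟫_ℝ =
      ⟪cross y (gradient Y₂ y), cross y (gradient Y₂ y)⟫_ℝ := by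
    rw [real_inner_comm]; exact inner_tau_g y (gradient Y₂ y)
  have f3 : ⟪y, cross (cross y (gradient Y₂ y)) y⟫_ℝ = 0 := by
    rw [real_inner_comm]; exact inner_cross_self_right _ _
  have f1 : ⟪gradient Y₁ y, cross (cross y (gradient Y₂ y)) y⟫_ℝ =
      lam * ⟪cross y (gradient Y₂ y), cross y (gradient Y₂ y)⟫_ℝ := by
    rw [hF, inner_add_left, real_inner_smul_left, real_inner_smul_left, f2, f3, mul_zero, add_zero]
  have h := transfer_inner_apply hE (cross (cross y (gradient Y₂ y)) y) y
  rw [hY₁.hessian_apply_self, hY₂.hessian_apply_self, real_inner_smul_left, real_inner_smul_left, f1, f2, f3,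
    mul_zero, mul_zero, add_zero, add_zero] at h
  have h3 : (Λ y - ((l₁ : ℝ) - l₂) * lam) * ⟪cross y (gradient Y₂ y), cross y (gradient Y₂ y)⟫_ℝ = 0 := by
    linear_combination -h
  exact sub_eq_zero.1 ((mul_eq_zero.1 h3).resolve_right hpos.ne')

/-- the axis point is excluded: `R₂ ≠ 0 ⇒ y ≠ 0`. -/
theorem ne_zero_of_rot_ne_zero {g : E3} (hR : cross y g ≠ 0) : y ≠ 0 := by
  rintro rfl
  apply hR
  ext i
  fin_cases i <;> simp [cross_apply_zero, cross_apply_one, cross_apply_two]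

/-- EULER FOR `μ`: `Dμ(y) = (l₁ − 2) μ` (the transfer tested on `(y, y)`). -/
theorem transfer_euler_mu (hY₁ : IsSolidHarmonic l₁ Y₁) (hY₂ : IsSolidHarmonic l₂ Y₂)
    (hF : gradient Y₁ y = lam • gradient Y₂ y + mu • y)
    (hE : ∀ w : E3, fderiv ℝ (gradient Y₁) y w =
      Λ w • gradient Y₂ y + lam • fderiv ℝ (gradient Y₂) y w + M w • y + mu • w)
    (hR : cross y (gradient Y₂ y) ≠ 0) (hΛy : Λ y = ((l₁ : ℝ) - l₂) * lam) :
    M y = ((l₁ : ℝ) - 2) * mu := by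
  have hy : y ≠ 0 := ne_zero_of_rot_ne_zero hR
  have hQ : 0 < ⟪y, y⟫_ℝ := real_inner_self_pos.2 hy
  have hFy : ⟪gradient Y₁ y, y⟫_ℝ = lam * ⟪gradient Y₂ y, y⟫_ℝ + mu * ⟪y, y⟫_ℝ := by
    rw [hF, inner_add_left, real_inner_smul_left, real_inner_smul_left]
  have h := transfer_inner_apply hE y y
  rw [hY₁.hessian_apply_self, hY₂.hessian_apply_self, real_inner_smul_left, real_inner_smul_left, hFy, hΛy] at h
  have h3 : (M y - ((l₁ : ℝ) - 2) * mu) * ⟪y, y⟫_ℝ = 0 := by linear_combination -h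
  exact sub_eq_zero.1 ((mul_eq_zero.1 h3).resolve_right hQ.ne')

/-- THE TRACE: `Dλ(∇Y₂) = −(l₁+1) μ` (both Laplacians vanish; `tr(w ↦ (Dλ w)∇Y₂ + (Dμ w)y + μw) = Dλ(∇Y₂) + Dμ(y) + 3μ`). -/
theorem transfer_trace (hY₁ : IsSolidHarmonic l₁ Y₁) (hY₂ : IsSolidHarmonic l₂ Y₂)
    (hE : ∀ w : E3, fderiv ℝ (gradient Y₁) y w =
      Λ w • gradient Y₂ y + lam • fderiv ℝ (gradient Y₂) y w + M w • y + mu • w)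
    (hMy : M y = ((l₁ : ℝ) - 2) * mu) :
    Λ (gradient Y₂ y) = -(((l₁ : ℝ) + 1) * mu) := by
  have htr₁ := hY₁.trace_hessian y
  have htr₂ := hY₂.trace_hessian y
  have c1 := clm_sum_coord Λ (gradient Y₂ y)
  have c2 := clm_sum_coord M y
  simp only [Fin.sum_univ_three] at htr₁ htr₂ c1 c2
  rw [transfer_inner_apply hE, transfer_inner_apply hE, transfer_inner_apply hE] at htr₁
  have he : ∀ i : Fin 3, ⟪e i, e i⟫_ℝ = 1 := fun i => by
    rw [inner_e_right]; simp [e]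
  rw [he 0, he 1, he 2] at htr₁
  linear_combination htr₁ - c1 - c2 - lam * htr₂ - hMy

/-- THE ANGULAR FORMS: `𝒜(Y₁) = λ³ 𝒜(Y₂)` (`y × ∇Y₁ = λR₂`, `R₂ ⊥ ∇Y₂, y`, Euler for `D(∇Y₂) y`). -/
theorem transfer_angForm (hY₁ : IsSolidHarmonic l₁ Y₁) (hY₂ : IsSolidHarmonic l₂ Y₂)
    (hF : gradient Y₁ y = lam • gradient Y₂ y + mu • y)
    (hE : ∀ w : E3, fderiv ℝ (gradient Y₁) y w =
      Λ w • gradient Y₂ y + lam • fderiv ℝ (gradient Y₂) y w + M w • y + mu • w) :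
    angForm Y₁ y = lam ^ 3 * angForm Y₂ y := by
  have hRg : ⟪cross y (gradient Y₂ y), gradient Y₂ y⟫_ℝ = 0 := inner_cross_self_right _ _
  have hRy : ⟪cross y (gradient Y₂ y), y⟫_ℝ = 0 := inner_cross_self_left _ _
  rw [hY₁.angForm_eq, hY₂.angForm_eq, hE (gradient Y₁ y), hF, cross_smul_add_smul_self]
  simp only [map_add, map_smul, hY₂.hessian_apply_self, inner_add_right, real_inner_smul_right, real_inner_smul_left,
    hRg, hRy, mul_zero, add_zero, zero_add, smul_smul]
  ring

end Pointwise

/-! ## §1b The Hessian transfer from the transfer law on a neighbourhood -/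

section Transfer

variable {l₁ l₂ : ℕ} {Y₁ Y₂ : E3 → ℝ} {lam mu : E3 → ℝ} {y : E3}

/-- differentiating `∇Y₁ = λ∇Y₂ + μy` (valid near `y`): `D(∇Y₁)w = (Dλw)∇Y₂ + λD(∇Y₂)w + (Dμw)y + μw`. -/
theorem hessian_transfer (hY₂ : IsSolidHarmonic l₂ Y₂)
    (hev : ∀ᶠ z in 𝓝 y, gradient Y₁ z = lam z • gradient Y₂ z + mu z • z)
    (hlam : DifferentiableAt ℝ lam y) (hmu : DifferentiableAt ℝ mu y) (w : E3) :
    fderiv ℝ (gradient Y₁) y w = fderiv ℝ lam y w • gradient Y₂ y + lam y • fderiv ℝ (gradient Y₂) y w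
      + fderiv ℝ mu y w • y + mu y • w := by
  have hg₂ : DifferentiableAt ℝ (gradient Y₂) y := (hY₂.contDiff_gradient.differentiable (by simp)) y
  have h : HasFDerivAt (fun z : E3 => lam z • gradient Y₂ z + mu z • z)
      ((lam y • fderiv ℝ (gradient Y₂) y + (fderiv ℝ lam y).smulRight (gradient Y₂ y))
        + (mu y • ContinuousLinearMap.id ℝ E3 + (fderiv ℝ mu y).smulRight y)) y :=
    (hlam.hasFDerivAt.smul hg₂.hasFDerivAt).add (hmu.hasFDerivAt.smul (hasFDerivAt_id y))
  have hev' : gradient Y₁ =ᶠ[𝓝 y] fun z : E3 => lam z • gradient Y₂ z + mu z • z := hev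
  rw [hev'.fderiv_eq, h.fderiv]
  simp only [add_apply, smul_apply, ContinuousLinearMap.smulRight_apply, ContinuousLinearMap.id_apply]
  abel

end Transfer

end Summit.NavierStokesRegularity.NavierStokesRegularity.Theorems.UnthreadedRigidity.CoZonal
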